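import Summits.Parity.BatemanHorn.Theorems.RoughValueTransportDefs
import Summits.Parity.BatemanHorn.Theses.RoughValueTransport

/-!
# Sketch — crux idea `relative-mass-split` (crux stmt-Parity-9469 `BalancedSemiprimeLayer`, round 2, ideator 4)

First-lemma signatures only (no proofs, nothing asserted).  Vocabulary from the tree:
`roughDivWindow` (`Theorems/RoughValueTransportDefs.lean`, namespace `…RoughRelaxedDivisorSieve`),
`CoordLayerThin` (`…SmoothModulusTwistedHooley`), `IsBatemanHornSystem`, `polyRootCountMod`.
-/

noncomputable section

open Polynomial Filter Finset
open Literature.NumberTheory.Sieve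
open scoped BigOperators

namespace Summit.Parity.BatemanHorn.Cruxes.BalancedSemiprimeLayer.RelativeMassSplit

open Summit.Parity.BatemanHorn.Cruxes.BalancedSemiprimeLayer.RoughRelaxedDivisorSieve (roughDivWindow divWindow)
open Summit.Parity.BatemanHorn.Cruxes.BalancedSemiprimeLayer.SmoothModulusTwistedHooley (CoordLayerThin)

/-- Small-root count of `g` modulo `m` in the class `s (mod e)` up to `x`:
`#{1 ≤ n ≤ x : n ≡ s (mod e), m ∣ g(n)}` (`e = 1`, `s = 0` is the plain count `N_m(x)`). -/
def classRootCount (g : ℤ[X]) (x m e s : ℕ) : ℕ :=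
  #((Ioc 0 x).filter fun n : ℕ => n ≡ s [MOD e] ∧ (m : ℤ) ∣ g.eval (n : ℤ))

/-- **H1 `WindowMass g`** — ORDER OF MAGNITUDE of the window-incidence mass, linear in `δ` with a
`δ`-free constant: `∃ c₀ > 0 ∀ 0 < c ≤ c₀ ∃ C ∀ 0 < δ ≤ c`, eventually in `x`,
`Σ_{m ∈ roughDivWindow d δ c x} N_m(x) ≤ C·δ·x`.  No congruence classes, no roots-in-progressions,
no main term, no power saving: "only `O(δx)` of the `n ≤ x` have an `x^c`-rough squarefree divisor of
`g(n)` in the balanced window `[x^{d(1−δ)/2}, x^{d(1+δ)/2}]`" (random model: `C ≍ d²/c²`). -/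
def WindowMass (g : ℤ[X]) : Prop :=
  ∃ c₀ : ℝ, 0 < c₀ ∧ ∀ c : ℝ, 0 < c → c ≤ c₀ → ∃ C : ℝ, ∀ δ : ℝ, 0 < δ → δ ≤ c →
    ∀ᶠ x : ℕ in atTop,
      ((∑ m ∈ roughDivWindow g.natDegree δ c x, classRootCount g x m 1 0 : ℕ) : ℝ) ≤ C * δ * x

/-- **H2 `RelativeRootLevel g`** — MAIN-TERM-FREE equidistribution of the window incidences over the
classes `n ≡ s (mod e)`, `e ≤ x^c` squarefree: the remainder is taken against `N_m(x)/e` (the ACTUAL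
count spread evenly), not against `(x/e)·ρ_g(m)/m` as in S8 `stub_roughWindowRootLevel_highDegree`.
(A power saving is stated to match S8's shape; the relative lever only needs `o(x/(log x)^k)`.) -/
def RelativeRootLevel (g : ℤ[X]) : Prop :=
  ∃ c₀ : ℝ, 0 < c₀ ∧ ∀ c : ℝ, 0 < c → c ≤ c₀ → ∀ δ : ℝ, 0 < δ → δ ≤ c →
    ∃ η : ℝ, 0 < η ∧ ∀ᶠ x : ℕ in atTop,
      (∑ e ∈ (Icc 1 ⌊(x : ℝ) ^ c⌋₊).filter Squarefree, ∑ s ∈ range e,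
        |∑ m ∈ roughDivWindow g.natDegree δ c x,
          ((classRootCount g x m e s : ℝ) - (classRootCount g x m 1 0 : ℝ) / e)|) ≤ (x : ℝ) ^ (1 - η)

/-- **The atom `PrimeWindowMass g`** (cleanest promotable form of H1; implied by `WindowMass`, since a
window prime is itself a rough squarefree window modulus): only `O(δx)` of the `n ≤ x` have a PRIME
factor of `g(n)` in the balanced window `divWindow d δ x = [x^{d(1−δ)/2}, x^{d(1+δ)/2}]`
(random model: `C = 2 + o(1)` as `δ → 0`, for EVERY irreducible `g` — no singular series). -/
def PrimeWindowMass (g : ℤ[X]) : Prop :=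
  ∃ C δ₀ : ℝ, 0 < δ₀ ∧ ∀ δ : ℝ, 0 < δ → δ ≤ δ₀ → ∀ᶠ x : ℕ in atTop,
    (#((Ioc 0 x).filter fun n : ℕ =>
        ∃ p ∈ divWindow g.natDegree δ x, p.Prime ∧ (p : ℤ) ∣ g.eval (n : ℤ)) : ℝ) ≤ C * δ * x

/-- **The dead zone, as a family of statements** (Barriers section of the card): "a proportion at
most `1 − η` of the `n ≤ x` have a prime factor of `g(n)` in `[x^a, x^b]`".  For an irreducible `g` of
degree `d ≥ 3` an instance with `η > 0` appears to be in print only for windows inside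
`[1, 1 + c_LPF(g)]` or with `a ≥ d − 1 − c_LPF(g)` (`c_LPF(X³+2) = 10⁻⁵²`, Irving 2015; Chebyshev–Hooley
mass identity for `a > d − 1`); nothing for `1 + c_LPF < a < d − 1 − c_LPF`.  `PrimeWindowMass` asks for
`η = 1 − Cδ` at `a, b = d(1 ∓ δ)/2`, the centre of that zone. -/
def DeadZoneBound (g : ℤ[X]) (a b η : ℝ) : Prop :=
  ∀ᶠ x : ℕ in atTop,
    (#((Ioc 0 x).filter fun n : ℕ => ∃ p ∈ Icc ⌈(x : ℝ) ^ a⌉₊ ⌊(x : ℝ) ^ b⌋₊,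
        p.Prime ∧ (p : ℤ) ∣ g.eval (n : ℤ)) : ℝ) ≤ (1 - η) * x

/-- **S8, restated as a `Prop`** (verbatim body of the registered stub
`RoughRelaxedDivisorSieve.stub_roughWindowRootLevel_highDegree` for one `g`, in the present
vocabulary; `polyRootCountMod ![g] m = ρ_g(m)`): ABSOLUTE root level in the balanced window. -/
def AbsoluteRootLevel (g : ℤ[X]) : Prop :=
  ∃ c₀ : ℝ, 0 < c₀ ∧ ∀ c : ℝ, 0 < c → c ≤ c₀ → ∀ δ : ℝ, 0 < δ → δ ≤ c →
    ∃ η : ℝ, 0 < η ∧ ∀ᶠ x : ℕ in atTop,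
      (∑ e ∈ (Icc 1 ⌊(x : ℝ) ^ c⌋₊).filter Squarefree, ∑ s ∈ range e,
        |∑ m ∈ roughDivWindow g.natDegree δ c x,
          ((classRootCount g x m e s : ℝ) - (x : ℝ) / e * ((polyRootCountMod ![g] m : ℝ) / m))|)
        ≤ (x : ℝ) ^ (1 - η)

/-- **First lemma of the line (the relative lever)** — for every coordinate of degree `≥ 2` of every
Bateman–Horn system, `WindowMass ∧ RelativeRootLevel` for that coordinate's polynomial imply that the
coordinate layer is thin.  Size M, provable now: the landed sieve step `stub_sifted_le`
(`Theorems/…RoughWindowSieveStep.lean`) re-run with the pair sequence of size `X := Σ_m N_m(x)` (actual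
mass) instead of `x·Σ_m ρᵢ(m)/m`; its remainders are then exactly the relative ones, and the spectator
fibration of the landed `stub_rootLevelTransfer` (p125151) carries the single-polynomial form to the
system form. -/
def RelativeLever : Prop :=
  ∀ (k : ℕ) (f : Fin k → ℤ[X]), IsBatemanHornSystem f → ∀ i : Fin k, 2 ≤ (f i).natDegree →
    WindowMass (f i) → RelativeRootLevel (f i) → CoordLayerThin f i

/-- **The split is a genuine weakening of S8**: absolute root level gives the relative one (triangle
inequality, `e = 1`, `s = 0` row) and, with the landed anchor `stub_roughWindowRhoSum`
(`x·Σ_{m ∈ RW} ρ(m)/m ≤ (d²δ/c² + o(1))·x`, p102251), the window mass. -/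
def SplitOfAbsolute : Prop :=
  ∀ g : ℤ[X], Irreducible g → 0 < g.leadingCoeff → 2 ≤ g.natDegree →
    AbsoluteRootLevel g → WindowMass g ∧ RelativeRootLevel g

/-- **The residual after the split, by name**: the crux's degree-`≥ 3` part follows from H1 ∧ H2 for
every irreducible `g` of degree `≥ 3` with positive leading coefficient (via `RelativeLever`, the landed
`stub_transfer` p78616 and `coordLayerThin_of_natDegree_le_two` p83112). -/
def CruxOfSplit : Prop :=
  RelativeLever →
    (∀ g : ℤ[X], Irreducible g → 0 < g.leadingCoeff → 3 ≤ g.natDegree →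
      WindowMass g ∧ RelativeRootLevel g) →
    Summit.Parity.BatemanHorn.Theses.RoughValueTransport.BalancedSemiprimeLayer

end Summit.Parity.BatemanHorn.Cruxes.BalancedSemiprimeLayer.RelativeMassSplit

end
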